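import Literature.NumberTheory.DiophantineGeometry.PartitionTableaux
import Mathlib.Data.List.GetD
import Mathlib.Logic.Equiv.Fintype
import Mathlib.Data.Fintype.Sum
import HarnessLib

/-!
# The dominance order on partitions and the partition `μ ⊔ ν` with the parts of `μ` and of `ν`

Pure partition combinatorics (no representation theory), continuing `PartitionTableaux`:

* `Nat.Partition.Dominates lam μ` — the **dominance order** `λ ⊵ μ`:
  `μ_1 + ⋯ + μ_p ≤ λ_1 + ⋯ + λ_p` for every `p`, the parts in weakly decreasing order
  (`Nat.Partition.sortedParts`) and padded by zeros (James, LNM 682, 3.2; Fulton, *Young Tableaux*,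
  §2.2). Partial sums are written `(sortedParts.take p).sum`; `sum_take_eq_sum_range_getD` converts
  to the zero-padded form `∑_{a < p} λ_a`.
* `Nat.Partition.append μ ν h` — for `μ ⊢ m`, `ν ⊢ m'` and `m + m' = n`, the partition of `n` whose
  parts are the parts of `μ` together with the parts of `ν` (the shape of the Young subgroup
  `S_μ × S_ν ≤ S_m × S_{m'} ≤ S_n`; written `μ ∪ ν` or `μ ⊔ ν` in the literature).
* `Nat.Partition.exists_rowEquiv_append` — a **row matching**: a bijection between the rows of
  `μ` and of `ν` on one side and the rows of `μ ⊔ ν` on the other which preserves row lengths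
  (the rows of `μ ⊔ ν` in decreasing order are a merge of those of `μ` and of `ν`). Built with
  Mathlib's `Equiv.ofFiberEquiv` from the equality of the number of rows of each length
  (`card_univ_filter_getD_eq_count`).

These serve the branching rule on Young sub-alphabets (`YoungSubalphabet.lean`) and the entropy
inequality `H(λ̄) ≤ H(μ ⊔ ν)` for `λ ⊵ μ ⊔ ν` behind Christandl–Vrana–Zuiddam's Lemma 3.10/3.11
(`Literature.Computability.AlgebraicComplexity.QuantumFunctionalsUpper`).

## References

* G. D. James, *The Representation Theory of the Symmetric Groups*, LNM 682 (1978), 3.2–3.4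
  (dominance order). [JamesLNM682]
* W. Fulton, *Young Tableaux*, LMS Student Texts 35 (1997), §2.2. [FultonYoungTableaux1997]

## Design

`Dominates` compares partitions of the same `n` only (all that is needed); it is stated with
`List.take` so that no index arithmetic is involved, and it is reflexive and transitive. The
declarations extending Mathlib's `Nat.Partition` are deliberate dot-notation extensions
(`_root_.Nat.Partition.…`), as in `PartitionTableaux`; none of these names exists in Mathlib.
-/

noncomputable section

open scoped BigOperators

namespace Literature.NumberTheory.DiophantineGeometry

/-! ### Zero-padded partial sums of a list -/

/-- Partial sums of a list of naturals in zero-padded form: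
`(L.take p).sum = ∑_{a < p} L.getD a 0`. [folklore] -/
theorem sum_take_eq_sum_range_getD (L : List ℕ) (p : ℕ) :
    (L.take p).sum = ∑ a ∈ Finset.range p, L.getD a 0 := by
  induction L generalizing p with
  | nil => simp
  | cons a L ih =>
    cases p with
    | zero => simp
    | succ p =>
      rw [List.take_succ_cons, List.sum_cons, Finset.sum_range_succ', List.getD_cons_zero, ih,
        add_comm]
      simp only [List.getD_cons_succ]

/-- Taking at least `length` elements takes the whole list, so the partial sum is the total.
[folklore] -/
theorem sum_take_of_length_le (L : List ℕ) {p : ℕ} (hp : L.length ≤ p) :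
    (L.take p).sum = L.sum := by
  rw [List.take_of_length_le hp]

/-- The number of positions of a list of naturals holding the value `c` is `List.count c`.
[folklore] -/
theorem card_univ_filter_getD_eq_count (L : List ℕ) (c : ℕ) :
    (Finset.univ.filter fun i : Fin L.length => L.getD i 0 = c).card = L.count c := by
  induction L with
  | nil => simp
  | cons a L ih =>
    rw [Finset.card_filter]
    change (∑ i : Fin (L.length + 1), if (a :: L).getD (i : ℕ) 0 = c then 1 else 0) = _
    rw [Fin.sum_univ_succ, List.count_cons]
    simp only [Fin.val_zero, List.getD_cons_zero, Fin.val_succ, List.getD_cons_succ]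
    rw [← Finset.card_filter, ih, add_comm]
    congr 1
    by_cases hac : a = c
    · subst hac; simp
    · simp [hac]

/-! ### The dominance order -/

/-- The **dominance order** on partitions of `d`: `lam.Dominates μ` (`λ ⊵ μ`) iff
`μ_1 + ⋯ + μ_p ≤ λ_1 + ⋯ + λ_p` for all `p`, parts in weakly decreasing order
(James, LNM 682, Definition 3.2; Fulton, *Young Tableaux*, §2.2). Declared in Mathlib's
`Nat.Partition` namespace for dot notation (deliberate extension; no such name in Mathlib).
[cite: JamesLNM682, Definition 3.2] -/
def _root_.Nat.Partition.Dominates {d : ℕ} (lam μ : Nat.Partition d) : Prop :=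
  ∀ p : ℕ, (μ.sortedParts.take p).sum ≤ (lam.sortedParts.take p).sum

/-- Unfolding of `Nat.Partition.Dominates`. [folklore] -/
theorem _root_.Nat.Partition.dominates_iff {d : ℕ} (lam μ : Nat.Partition d) :
    lam.Dominates μ ↔ ∀ p : ℕ, (μ.sortedParts.take p).sum ≤ (lam.sortedParts.take p).sum :=
  Iff.rfl

/-- Dominance is reflexive. [folklore] -/
theorem _root_.Nat.Partition.dominates_refl {d : ℕ} (lam : Nat.Partition d) : lam.Dominates lam :=
  fun _ => le_rfl

/-- Dominance is transitive. [folklore] -/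
theorem _root_.Nat.Partition.Dominates.trans {d : ℕ} {lam μ ν : Nat.Partition d}
    (h₁ : lam.Dominates μ) (h₂ : μ.Dominates ν) : lam.Dominates ν :=
  fun p => (h₂ p).trans (h₁ p)

/-- Dominance in zero-padded form: `∑_{a<p} μ_a ≤ ∑_{a<p} λ_a`. [folklore] -/
theorem _root_.Nat.Partition.Dominates.sum_range_getD_le {d : ℕ} {lam μ : Nat.Partition d}
    (h : lam.Dominates μ) (p : ℕ) :
    ∑ a ∈ Finset.range p, μ.sortedParts.getD a 0 ≤ ∑ a ∈ Finset.range p, lam.sortedParts.getD a 0 := by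
  rw [← sum_take_eq_sum_range_getD, ← sum_take_eq_sum_range_getD]
  exact h p

/-! ### The partition with the parts of `μ` and of `ν` -/

/-- For `μ ⊢ m`, `ν ⊢ m'` and `m + m' = n`: the partition `μ ⊔ ν ⊢ n` whose multiset of parts is
`μ.parts + ν.parts` (the row type of the Young subgroup `S_μ × S_ν ≤ S_m × S_{m'} ≤ S_n`, often
written `μ ∪ ν`). Declared in Mathlib's `Nat.Partition` namespace for dot notation (deliberate
extension; no such name in Mathlib). [folklore] -/
def _root_.Nat.Partition.append {m m' n : ℕ} (μ : Nat.Partition m) (ν : Nat.Partition m')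
    (h : m + m' = n) : Nat.Partition n where
  parts := μ.parts + ν.parts
  parts_pos hi := by
    rcases Multiset.mem_add.1 hi with hi | hi
    exacts [μ.parts_pos hi, ν.parts_pos hi]
  parts_sum := by rw [Multiset.sum_add, μ.parts_sum, ν.parts_sum, h]

/-- The parts of `μ ⊔ ν` are the parts of `μ` together with the parts of `ν`. [folklore] -/
@[simp] theorem _root_.Nat.Partition.parts_append {m m' n : ℕ} (μ : Nat.Partition m)
    (ν : Nat.Partition m') (h : m + m' = n) : (μ.append ν h).parts = μ.parts + ν.parts :=
  rfl

/-- Row `a` of a partition has `sortedParts.getD a 0` boxes; the number of rows of length `c ≥ 1`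
is the multiplicity of `c` as a part. [folklore] -/
theorem card_univ_filter_sortedParts_getD_eq_count {d : ℕ} (μ : Nat.Partition d) (c : ℕ) :
    (Finset.univ.filter fun i : Fin μ.sortedParts.length => μ.sortedParts.getD i 0 = c).card =
      μ.parts.count c := by
  rw [card_univ_filter_getD_eq_count, ← Multiset.coe_count, Nat.Partition.sortedParts,
    Multiset.sort_eq]

/-- **Row matching for `μ ⊔ ν`**: there is a bijection between (rows of `μ`) ⊔ (rows of `ν`) and
the rows of `μ ⊔ ν` preserving row lengths — the decreasing rearrangement of the parts of `μ` and
of `ν` together is a merge of the two decreasing lists. Constructed fibrewise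
(`Equiv.ofFiberEquiv`) from the equality of the number of rows of each length. [folklore] -/
theorem _root_.Nat.Partition.exists_rowEquiv_append {m m' n : ℕ} (μ : Nat.Partition m)
    (ν : Nat.Partition m') (h : m + m' = n) :
    ∃ e : Fin μ.sortedParts.length ⊕ Fin ν.sortedParts.length ≃
        Fin (μ.append ν h).sortedParts.length,
      (∀ r, (μ.append ν h).sortedParts.getD (e (Sum.inl r)) 0 = μ.sortedParts.getD r 0) ∧
      (∀ r, (μ.append ν h).sortedParts.getD (e (Sum.inr r)) 0 = ν.sortedParts.getD r 0) := by
  classical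
  let f : Fin μ.sortedParts.length ⊕ Fin ν.sortedParts.length → ℕ :=
    Sum.elim (fun r => μ.sortedParts.getD r 0) (fun r => ν.sortedParts.getD r 0)
  let g : Fin (μ.append ν h).sortedParts.length → ℕ := fun i => (μ.append ν h).sortedParts.getD i 0
  have hcard : ∀ c, Fintype.card {s // f s = c} = Fintype.card {i // g i = c} := by
    intro c
    rw [Fintype.card_congr (Equiv.subtypeSum (p := fun s => f s = c)), Fintype.card_sum]
    change Fintype.card {r : Fin μ.sortedParts.length // μ.sortedParts.getD r 0 = c} +
        Fintype.card {r : Fin ν.sortedParts.length // ν.sortedParts.getD r 0 = c} =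
      Fintype.card {i : Fin (μ.append ν h).sortedParts.length //
        (μ.append ν h).sortedParts.getD i 0 = c}
    rw [Fintype.card_subtype, Fintype.card_subtype, Fintype.card_subtype,
      card_univ_filter_sortedParts_getD_eq_count, card_univ_filter_sortedParts_getD_eq_count,
      card_univ_filter_sortedParts_getD_eq_count, Nat.Partition.parts_append, Multiset.count_add]
  refine ⟨Equiv.ofFiberEquiv fun c => Fintype.equivOfCardEq (hcard c), fun r => ?_, fun r => ?_⟩
  · exact Equiv.ofFiberEquiv_map (fun c => Fintype.equivOfCardEq (hcard c)) (Sum.inl r)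
  · exact Equiv.ofFiberEquiv_map (fun c => Fintype.equivOfCardEq (hcard c)) (Sum.inr r)

end Literature.NumberTheory.DiophantineGeometry

end
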